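import Summits.QuantumFields.YangMills.Theorems.BalabanUVNodesN15TwoGridLandauEntry0Full
import HarnessLib

/-!
# Route «BalabanUVNodes», node N15 = NE2, -a lane, part 53: DOOR (iv) — THE KERNEL RATE OF `∂Π∂*` AND THE LANDAU TWO-GRID DEFECT `V′P − PV`, HYPOTHESIS-FREE ON THE TORUS FAMILY

Cell `pub-ymgap`, seat `pub-ymgap-dag-n15-a` (KNIT-BY-NAME, g12); `--supports stmt-QuantumFields-20290 --as helper`; `HOME/pub-ymgap-dag-n15-a/DOOR-IV-PLAN.md` §7.4.
Over parts 47 (`hasMaj_landauDefect_of_kernelRate`), 48 (`kernelRate_core`), 49 (`abs_kerRe_sub_le`), 52 (`KRe_pairRate_member`, `DKRe_pairRate_member`) and the tree's (1.126) engine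
(`B5QGGQ145Factor.KRe_decay`, `B5DPD126Uniform.DKRe_decay ∕ kerRe_decay`).
WHY.  Parts 48∕49 derived part 47's binder `hK` — the CELL-SUMMED TWO-GRID η-RATE OF THE (1.126) KERNEL of `V = ∂Π∂*` — only INTERNALLY, on the way to the sandwiched statements
`hasMaj_twoGridDefect_of_factorRates ∕ _of_kernelPairRates`; entry 3 of (3.42) (part 54: `Δ′G′P − PΔG` through (1.73)) needs the UNSANDWICHED defect `(V′P − PV)∘G`, hence `hK` itself.
WHAT.  (§58) `kernelRate_of_factorRates`, `kernelRate_of_kernelPairRates`: the derivations of parts 48∕49 with the conclusion changed to `∃ δK CK > 0, hK` (same proofs).  (§59) ★ `kernelRate_family`: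
`hK` HYPOTHESIS-FREE on the torus family of record at King's couplings `a_k = aK a L k`, `a_{k+m}` (part 52's paired rates + the tree's decays on the window `[aminL a L, a]`), rate
`(L^k)^{−γ∕2}`; ★ `hasMaj_landauDefect_family`: for odd `L ≥ 3`, `a > 0`, `0 < γ < 1`, `∃ δ C > 0 ∀ m_T, k ≥ 1, m`: `HasMaj (ofBlocks … blkFine) (ofBlocks … blockOf_{L^m·L^k}) (V′∘P − P∘V)
(C·(L^k)^{−γ∕2}·e^{−δ|y−y′|_T})`, `V = landauRe`, `P = pull kingPrV` — the Landau line of the two-grid consistency of `Δ_a`, ALONE (no propagator sandwich), hypothesis-free.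
HONEST FRAMING ∕ LIMITS.  `U ≡ 1` torus family, King's couplings; count-neutral (typed 28∕28 · discharged 5∕27 of record unchanged); NOT a discharge of N15 (object-bound; NE2⁺ NOT PRINTED); one finite
T⁴ at fixed ε — NOT infinite volume, NOT OS on ℝ⁴, NOT a mass gap, NOT Clay.
-/

noncomputable section

open scoped BigOperators Matrix
open Finset

namespace Summit.QuantumFields.YangMills.BalabanUVNodes.N15.TwoGrid

open Literature.MathematicalPhysics.QuantumFieldTheory.Balaban1983to89
open Literature.MathematicalPhysics.QuantumFieldTheory.Balaban1983to89.B11SectG (BlockNorm HasMaj)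
open Literature.MathematicalPhysics.QuantumFieldTheory.Balaban1983to89.T4EtaRateCoeffDefect (pull pull_apply fibre mem_fibre)
open Literature.MathematicalPhysics.QuantumFieldTheory.Balaban1983to89.B5Prop11Plancherel (Tor fine)
open Literature.MathematicalPhysics.QuantumFieldTheory.Balaban1983to89.B5Prop12FieldsLattice (distU distU_nonneg)
open Literature.MathematicalPhysics.QuantumFieldTheory.Balaban1983to89.B5SiteBridgeP12 (MP)
open Literature.MathematicalPhysics.QuantumFieldTheory.Balaban1983to89.B4Sect5Torus (tdist tdist_nonneg)
open Literature.MathematicalPhysics.QuantumFieldTheory.Balaban1983to89.B4TorusKernel (periodConst)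
open Literature.MathematicalPhysics.QuantumFieldTheory.Balaban1983to89.B4TorusKernel.MultiPeriod (torusSupNorm)
open Literature.MathematicalPhysics.QuantumFieldTheory.Balaban1983to89.B5QGGQ145Bounds (Idx toZ kerRe)
open Literature.MathematicalPhysics.QuantumFieldTheory.Balaban1983to89.B5QGGQ145Factor (KRe KRe_decay)
open Literature.MathematicalPhysics.QuantumFieldTheory.Balaban1983to89.B5DPD126Uniform (DKRe cIdx toZ_cIdx tdist_eq_torusSupNorm DKRe_decay kerRe_decay)
open Literature.MathematicalPhysics.QuantumFieldTheory.Balaban1983to89.B5PBridgeProjection (torIdx)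
open Literature.MathematicalPhysics.QuantumFieldTheory.King1986 (aK)
open Literature.MathematicalPhysics.QuantumFieldTheory.King1986.Torus (blockOf tdistT tdistT_nonneg aminL aminL_pos aminL_le_aK)
open Literature.MathematicalPhysics.QuantumFieldTheory.Balaban1983to89.B6UnitTorusCarrier (unitTorusGeo)
open Summit.QuantumFields.YangMills.BalabanUVNodes.N15.VectorPiece (blkFine kingPr kingPrV)

variable {d : ℕ}

/-! ## §58 The kernel rate of `∂Π∂*` from factor rates ∕ paired factor rates (parts 48∕49's derivations, conclusion exposed) -/

section KernelRate

variable {L : ℕ} [NeZero L]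

/-- **FACTOR RATES ⇒ THE KERNEL RATE `hK` OF PART 47** (part 48's derivation, exposed): uniform decays of `∂K_T` and `(K_T*K_T)⁻¹` on a coupling window `[a₋, a₊]` (the tree) plus their
two-grid η-RATES at rate `(L^k)^{−γ}` give the cell-summed two-grid rate of the (1.126) kernel of `∂Π∂*`, with ONE rate `δK` and ONE constant `CK` for the whole torus family.
[cite: Balaban1984PropagatorsI, (1.126) p.38, p.38 ll.7–10; King1986, Prop. 3.9 p.665 (η-rate shape)] -/
theorem kernelRate_of_factorRates (hL : Odd L ∧ 1 < L) {aminus aplus : ℝ} (hamin : 0 < aminus) {γ : ℝ} {δR ρ : ℝ} (hδR : 0 < δR) (hρ : 0 < ρ)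
    (hfac : ∀ (mT k m : ℕ) (hk : 1 ≤ k), ∃ a a' : ℝ, aminus ≤ a ∧ a ≤ aplus ∧ aminus ≤ a' ∧ a' ≤ aplus ∧
      (∀ (s : Fin (d + 1)) (w' : Tor (fine (L ^ m * L ^ k) (MP (paramsOf d L mT k hL)))) (k' : Idx (MP (paramsOf d L mT k hL))),
        |DKRe (L ^ m * L ^ k) a' (MP (paramsOf d L mT k hL)) s (torIdx (fine (L ^ m * L ^ k) (MP (paramsOf d L mT k hL))) w') k'
            - DKRe (L ^ k) a (MP (paramsOf d L mT k hL)) s (torIdx (fine (L ^ k) (MP (paramsOf d L mT k hL))) (kingPr L k m (MP (paramsOf d L mT k hL)) w')) k'|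
          ≤ ρ * ((L ^ k : ℕ) : ℝ) ^ (-γ) *
            Real.exp (-(δR * tdist (MP (paramsOf d L mT k hL)) (cIdx (L ^ k) (MP (paramsOf d L mT k hL)) (torIdx (fine (L ^ k) (MP (paramsOf d L mT k hL))) (kingPr L k m (MP (paramsOf d L mT k hL)) w'))) k'))) ∧
      (∀ k₁ k₂ : Idx (MP (paramsOf d L mT k hL)),
        |kerRe (L ^ m * L ^ k) a' (MP (paramsOf d L mT k hL)) k₁ k₂ - kerRe (L ^ k) a (MP (paramsOf d L mT k hL)) k₁ k₂|
          ≤ ρ * ((L ^ k : ℕ) : ℝ) ^ (-γ) * Real.exp (-(δR * tdist (MP (paramsOf d L mT k hL)) k₁ k₂)))) :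
    ∃ δK CK : ℝ, 0 < δK ∧ 0 < CK ∧ ∀ (mT k m : ℕ) (hk : 1 ≤ k) (x' : Tor (fine (L ^ m * L ^ k) (MP (paramsOf d L mT k hL)))) (μ : Fin (d + 1))
      (z : Tor (fine (L ^ k) (MP (paramsOf d L mT k hL)))) (ν : Fin (d + 1)),
      |∑ w' ∈ fibre (kingPr L k m (MP (paramsOf d L mT k hL))) z, landauRe (MP (paramsOf d L mT k hL)) (L ^ m * L ^ k) (Pi.single (w', ν) 1) (x', μ)
          - landauRe (MP (paramsOf d L mT k hL)) (L ^ k) (Pi.single (z, ν) 1) (kingPr L k m (MP (paramsOf d L mT k hL)) x', μ)|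
        ≤ CK * ((L ^ k : ℕ) : ℝ) ^ (-γ) * ((((L ^ k : ℕ) : ℝ)) ^ (d + 1))⁻¹ * Real.exp (-(δK * distU (L ^ k) (MP (paramsOf d L mT k hL)) (kingPr L k m (MP (paramsOf d L mT k hL)) x') z)) := by
  -- the tree's uniform decays of the two factors on `[a₋, a₊]`
  obtain ⟨κ₁, M₁, hκ₁, hM₁, HD⟩ := DKRe_decay d aminus aplus hamin
  obtain ⟨κ₂, M₂, hκ₂, hM₂, HK⟩ := kerRe_decay d aminus aplus hamin
  -- one rate and one constant for everything
  obtain ⟨δ, hδ⟩ : ∃ δ : ℝ, δ = min (min (κ₁ / (d + 1)) (κ₂ / (d + 1))) δR := ⟨_, rfl⟩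
  have hd1 : (0 : ℝ) < (d : ℝ) + 1 := by positivity
  have hδpos : 0 < δ := hδ ▸ lt_min (lt_min (div_pos hκ₁ hd1) (div_pos hκ₂ hd1)) hδR
  have hδ1 : δ ≤ κ₁ / (d + 1) := hδ ▸ (min_le_left _ _).trans (min_le_left _ _)
  have hδ2 : δ ≤ κ₂ / (d + 1) := hδ ▸ (min_le_left _ _).trans (min_le_right _ _)
  have hδ3 : δ ≤ δR := hδ ▸ min_le_right _ _
  have hpc1 : 0 ≤ periodConst κ₁ d := (B5Kernel166Decay.periodConst_pos hκ₁ d).le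
  have hpc2 : 0 ≤ periodConst κ₂ d := (B5Kernel166Decay.periodConst_pos hκ₂ d).le
  obtain ⟨CD, hCD⟩ : ∃ CD : ℝ, CD = max (M₁ * periodConst κ₁ d) (M₂ * periodConst κ₂ d) := ⟨_, rfl⟩
  have hCD0 : 0 ≤ CD := hCD ▸ le_max_of_le_left (mul_nonneg hM₁ hpc1)
  have hCD1 : M₁ * periodConst κ₁ d ≤ CD := hCD ▸ le_max_left _ _
  have hCD2 : M₂ * periodConst κ₂ d ≤ CD := hCD ▸ le_max_right _ _
  have hK2 : 0 ≤ B4Sect5Proof.latticeConst (d + 1) (δ / 2) := B4Sect5Proof.latticeConst_nonneg _ (by positivity)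
  have hK4 : 0 ≤ B4Sect5Proof.latticeConst (d + 1) (δ / 4) := B4Sect5Proof.latticeConst_nonneg _ (by positivity)
  obtain ⟨CK, hCK⟩ : ∃ CK : ℝ, CK = (2 * ρ + ρ) * CD ^ 2 * B4Sect5Proof.latticeConst (d + 1) (δ / 2) * B4Sect5Proof.latticeConst (d + 1) (δ / 4) * Real.exp (δ / 4) := ⟨_, rfl⟩
  have hCK0 : 0 ≤ CK := hCK ▸ mul_nonneg (mul_nonneg (mul_nonneg (mul_nonneg (by positivity) (sq_nonneg _)) hK2) hK4) (Real.exp_nonneg _)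
  refine ⟨δ / 4, CK + 1, by positivity, by linarith, fun mT k m hk x' μ z ν => ?_⟩
  obtain ⟨a, a', ha1, ha2, ha1', ha2', HR1, HR3⟩ := hfac mT k m hk
  have ha : 0 < a := hamin.trans_le ha1
  have ha' : 0 < a' := hamin.trans_le ha1'
  have hM1 : ∀ i, 1 ≤ (MP (paramsOf d L mT k hL)) i := fun i => Nat.one_le_iff_ne_zero.mpr (NeZero.ne ((MP (paramsOf d L mT k hL)) i))
  have hL0 : 0 < L := Nat.pos_of_ne_zero (NeZero.ne L)
  haveI : NeZero (L ^ m * L ^ k) := ⟨Nat.mul_ne_zero (pow_ne_zero _ (NeZero.ne L)) (pow_ne_zero _ (NeZero.ne L))⟩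
  have hn0 : (0 : ℝ) < ((L ^ k : ℕ) : ℝ) := by exact_mod_cast Nat.one_le_pow _ _ hL0
  have hrγ : 0 ≤ ((L ^ k : ℕ) : ℝ) ^ (-γ) := Real.rpow_nonneg hn0.le _
  -- monotonicity helper: a tree decay `C·pc·e^{−(κ/(d+1))·‖·‖}` in `torusSupNorm` currency is `≤ CD·e^{−δ t}`
  have hmono : ∀ {C pc κ' : ℝ} {N0 : Fin (d + 1) → ℕ} (_ : ∀ i, 1 ≤ N0 i) (X k' : Idx N0), C * pc ≤ CD → δ ≤ κ' →
      C * pc * Real.exp (-(κ' * torusSupNorm N0 (toZ X - toZ k'))) ≤ CD * Real.exp (-(δ * tdist N0 X k')) := by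
    intro C pc κ' N0 hN0 X k' hC hκ
    rw [← tdist_eq_torusSupNorm hN0]
    by_cases hCp : 0 ≤ C * pc
    · exact mul_le_mul hC (Real.exp_le_exp.mpr (by nlinarith [tdist_nonneg N0 X k'])) (Real.exp_nonneg _) hCD0
    · have h1 : C * pc * Real.exp (-(κ' * tdist N0 X k')) ≤ 0 := mul_nonpos_of_nonpos_of_nonneg (le_of_lt (not_le.mp hCp)) (Real.exp_nonneg _)
      exact h1.trans (mul_nonneg hCD0 (Real.exp_nonneg _))
  have hDKn : ∀ (n : ℕ) [NeZero n] {b : ℝ}, aminus ≤ b → b ≤ aplus → ∀ (s : Fin (d + 1)) (X : Idx (fun i => n * (MP (paramsOf d L mT k hL)) i)) (k' : Idx (MP (paramsOf d L mT k hL))),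
      |DKRe n b (MP (paramsOf d L mT k hL)) s X k'| ≤ CD * Real.exp (-(δ * tdist (MP (paramsOf d L mT k hL)) (cIdx n (MP (paramsOf d L mT k hL)) X) k')) := by
    intro n _ b hb1 hb2 s X k'
    have h := HD n b hb1 hb2 (MP (paramsOf d L mT k hL)) hM1 s X k'
    rw [← toZ_cIdx] at h
    exact h.trans (hmono hM1 (cIdx n (MP (paramsOf d L mT k hL)) X) k' hCD1 hδ1)
  have hkern : ∀ (n : ℕ) [NeZero n] {b : ℝ}, aminus ≤ b → b ≤ aplus → ∀ k₁ k₂ : Idx (MP (paramsOf d L mT k hL)), |kerRe n b (MP (paramsOf d L mT k hL)) k₁ k₂| ≤ CD * Real.exp (-(δ * tdist (MP (paramsOf d L mT k hL)) k₁ k₂)) := by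
    intro n _ b hb1 hb2 k₁ k₂
    exact (HK n b hb1 hb2 (MP (paramsOf d L mT k hL)) hM1 k₁ k₂).trans (hmono hM1 k₁ k₂ hCD2 hδ2)
  have hR1' : ∀ (s : Fin (d + 1)) (w' : Tor (fine (L ^ m * L ^ k) (MP (paramsOf d L mT k hL)))) (k' : Idx (MP (paramsOf d L mT k hL))),
      |DKRe (L ^ m * L ^ k) a' (MP (paramsOf d L mT k hL)) s (torIdx (fine (L ^ m * L ^ k) (MP (paramsOf d L mT k hL))) w') k' - DKRe (L ^ k) a (MP (paramsOf d L mT k hL)) s (torIdx (fine (L ^ k) (MP (paramsOf d L mT k hL))) (kingPr L k m (MP (paramsOf d L mT k hL)) w')) k'|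
        ≤ ρ * ((L ^ k : ℕ) : ℝ) ^ (-γ) * Real.exp (-(δ * tdist (MP (paramsOf d L mT k hL)) (cIdx (L ^ k) (MP (paramsOf d L mT k hL)) (torIdx (fine (L ^ k) (MP (paramsOf d L mT k hL))) (kingPr L k m (MP (paramsOf d L mT k hL)) w'))) k')) :=
    fun s w' k' => (HR1 s w' k').trans (mul_le_mul_of_nonneg_left (Real.exp_le_exp.mpr (by nlinarith [tdist_nonneg (MP (paramsOf d L mT k hL)) (cIdx (L ^ k) (MP (paramsOf d L mT k hL)) (torIdx (fine (L ^ k) (MP (paramsOf d L mT k hL))) (kingPr L k m (MP (paramsOf d L mT k hL)) w'))) k']))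
      (mul_nonneg hρ.le hrγ))
  have hR3' : ∀ k₁ k₂ : Idx (MP (paramsOf d L mT k hL)), |kerRe (L ^ m * L ^ k) a' (MP (paramsOf d L mT k hL)) k₁ k₂ - kerRe (L ^ k) a (MP (paramsOf d L mT k hL)) k₁ k₂| ≤ ρ * ((L ^ k : ℕ) : ℝ) ^ (-γ) * Real.exp (-(δ * tdist (MP (paramsOf d L mT k hL)) k₁ k₂)) :=
    fun k₁ k₂ => (HR3 k₁ k₂).trans (mul_le_mul_of_nonneg_left (Real.exp_le_exp.mpr (by nlinarith [tdist_nonneg (MP (paramsOf d L mT k hL)) k₁ k₂])) (mul_nonneg hρ.le hrγ))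
  have hcore := kernelRate_core (MP (paramsOf d L mT k hL)) k m ha ha' hCD0 hδpos (mul_nonneg hρ.le hrγ) (mul_nonneg hρ.le hrγ)
    (hDKn (L ^ k) ha1 ha2) (hDKn (L ^ m * L ^ k) ha1' ha2') (hkern (L ^ k) ha1 ha2) (hkern (L ^ m * L ^ k) ha1' ha2') hR1' hR3' x' μ z ν
  refine hcore.trans ?_
  have hE := Real.exp_nonneg (-(δ / 4 * distU (L ^ k) (MP (paramsOf d L mT k hL)) (kingPr L k m (MP (paramsOf d L mT k hL)) x') z))
  have hI : 0 ≤ ((((L ^ k : ℕ) : ℝ)) ^ (d + 1))⁻¹ := inv_nonneg.mpr (pow_nonneg hn0.le _)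
  have heq : (2 * (ρ * ((L ^ k : ℕ) : ℝ) ^ (-γ)) + ρ * ((L ^ k : ℕ) : ℝ) ^ (-γ)) * CD ^ 2 * B4Sect5Proof.latticeConst (d + 1) (δ / 2) * B4Sect5Proof.latticeConst (d + 1) (δ / 4)
      * Real.exp (δ / 4) * 1 = CK * ((L ^ k : ℕ) : ℝ) ^ (-γ) := by rw [hCK]; ring
  rw [heq]
  exact mul_le_mul_of_nonneg_right (mul_le_mul_of_nonneg_right (mul_le_mul_of_nonneg_right (by linarith) hrγ) hI) hE

/-- **PAIRED FACTOR RATES ⇒ THE KERNEL RATE `hK`** (part 49's derivation, exposed): the η-rates of the PAIRS `(K_T, ∂K_T)` (King (3.71) lines 1–2) give the rate of the inverse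
`(K_T*K_T)⁻¹` by the resolvent identity (`abs_kerRe_sub_le`) and hence, by `kernelRate_of_factorRates`, the kernel rate. [cite: Balaban1984PropagatorsI, (1.126) p.38; King1986, Prop. 3.8 (3.71) p.664, Prop. 3.9 p.665] -/
theorem kernelRate_of_kernelPairRates (hL : Odd L ∧ 1 < L) {aminus aplus : ℝ} (hamin : 0 < aminus) {γ : ℝ} {δR ρ : ℝ} (hδR : 0 < δR) (hρ : 0 < ρ)
    (hpair : ∀ (mT k m : ℕ) (hk : 1 ≤ k), ∃ a a' : ℝ, aminus ≤ a ∧ a ≤ aplus ∧ aminus ≤ a' ∧ a' ≤ aplus ∧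
      (∀ (w' : Tor (fine (L ^ m * L ^ k) (MP (paramsOf d L mT k hL)))) (k' : Idx (MP (paramsOf d L mT k hL))),
        |KRe (L ^ m * L ^ k) a' (MP (paramsOf d L mT k hL)) (torIdx (fine (L ^ m * L ^ k) (MP (paramsOf d L mT k hL))) w') k'
            - KRe (L ^ k) a (MP (paramsOf d L mT k hL)) (torIdx (fine (L ^ k) (MP (paramsOf d L mT k hL))) (kingPr L k m (MP (paramsOf d L mT k hL)) w')) k'|
          ≤ ρ * ((L ^ k : ℕ) : ℝ) ^ (-γ) *
            Real.exp (-(δR * tdist (MP (paramsOf d L mT k hL)) (cIdx (L ^ k) (MP (paramsOf d L mT k hL)) (torIdx (fine (L ^ k) (MP (paramsOf d L mT k hL))) (kingPr L k m (MP (paramsOf d L mT k hL)) w'))) k'))) ∧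
      (∀ (s : Fin (d + 1)) (w' : Tor (fine (L ^ m * L ^ k) (MP (paramsOf d L mT k hL)))) (k' : Idx (MP (paramsOf d L mT k hL))),
        |DKRe (L ^ m * L ^ k) a' (MP (paramsOf d L mT k hL)) s (torIdx (fine (L ^ m * L ^ k) (MP (paramsOf d L mT k hL))) w') k'
            - DKRe (L ^ k) a (MP (paramsOf d L mT k hL)) s (torIdx (fine (L ^ k) (MP (paramsOf d L mT k hL))) (kingPr L k m (MP (paramsOf d L mT k hL)) w')) k'|
          ≤ ρ * ((L ^ k : ℕ) : ℝ) ^ (-γ) *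
            Real.exp (-(δR * tdist (MP (paramsOf d L mT k hL)) (cIdx (L ^ k) (MP (paramsOf d L mT k hL)) (torIdx (fine (L ^ k) (MP (paramsOf d L mT k hL))) (kingPr L k m (MP (paramsOf d L mT k hL)) w'))) k')))) :
    ∃ δK CK : ℝ, 0 < δK ∧ 0 < CK ∧ ∀ (mT k m : ℕ) (hk : 1 ≤ k) (x' : Tor (fine (L ^ m * L ^ k) (MP (paramsOf d L mT k hL)))) (μ : Fin (d + 1))
      (z : Tor (fine (L ^ k) (MP (paramsOf d L mT k hL)))) (ν : Fin (d + 1)),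
      |∑ w' ∈ fibre (kingPr L k m (MP (paramsOf d L mT k hL))) z, landauRe (MP (paramsOf d L mT k hL)) (L ^ m * L ^ k) (Pi.single (w', ν) 1) (x', μ)
          - landauRe (MP (paramsOf d L mT k hL)) (L ^ k) (Pi.single (z, ν) 1) (kingPr L k m (MP (paramsOf d L mT k hL)) x', μ)|
        ≤ CK * ((L ^ k : ℕ) : ℝ) ^ (-γ) * ((((L ^ k : ℕ) : ℝ)) ^ (d + 1))⁻¹ * Real.exp (-(δK * distU (L ^ k) (MP (paramsOf d L mT k hL)) (kingPr L k m (MP (paramsOf d L mT k hL)) x') z)) := by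
  -- the tree's uniform decays on `[a₋, a₊]`
  obtain ⟨κ₁, M₁, hκ₁, hM₁, HKd⟩ := KRe_decay d aminus aplus hamin
  obtain ⟨κ₂, M₂, hκ₂, hM₂, HId⟩ := kerRe_decay d aminus aplus hamin
  have hd1 : (0 : ℝ) < (d : ℝ) + 1 := by positivity
  obtain ⟨δ, hδ⟩ : ∃ δ : ℝ, δ = min (min (κ₁ / (d + 1)) (κ₂ / (d + 1))) δR := ⟨_, rfl⟩
  have hδpos : 0 < δ := hδ ▸ lt_min (lt_min (div_pos hκ₁ hd1) (div_pos hκ₂ hd1)) hδR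
  have hδ1 : δ ≤ κ₁ / (d + 1) := hδ ▸ (min_le_left _ _).trans (min_le_left _ _)
  have hδ2 : δ ≤ κ₂ / (d + 1) := hδ ▸ (min_le_left _ _).trans (min_le_right _ _)
  have hδ3 : δ ≤ δR := hδ ▸ min_le_right _ _
  have hpc1 : 0 ≤ periodConst κ₁ d := (B5Kernel166Decay.periodConst_pos hκ₁ d).le
  have hpc2 : 0 ≤ periodConst κ₂ d := (B5Kernel166Decay.periodConst_pos hκ₂ d).le
  obtain ⟨CK, hCK⟩ : ∃ CK : ℝ, CK = M₁ * periodConst κ₁ d := ⟨_, rfl⟩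
  obtain ⟨CI, hCI⟩ : ∃ CI : ℝ, CI = M₂ * periodConst κ₂ d := ⟨_, rfl⟩
  have hCK0 : 0 ≤ CK := hCK ▸ mul_nonneg hM₁ hpc1
  have hCI0 : 0 ≤ CI := hCI ▸ mul_nonneg hM₂ hpc2
  have hK2 : 0 ≤ B4Sect5Proof.latticeConst (d + 1) (δ / 2) := B4Sect5Proof.latticeConst_nonneg _ (by positivity)
  have hK4 : 0 ≤ B4Sect5Proof.latticeConst (d + 1) (δ / 2 / 2) := B4Sect5Proof.latticeConst_nonneg _ (by positivity)
  have hK8 : 0 ≤ B4Sect5Proof.latticeConst (d + 1) (δ / 2 / 4) := B4Sect5Proof.latticeConst_nonneg _ (by positivity)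
  -- the constant of `ρ₃` per unit of `ρ(L^k)^{−γ}`
  obtain ⟨C3, hC3⟩ : ∃ C3 : ℝ, C3 = CI * (2 * CK * B4Sect5Proof.latticeConst (d + 1) (δ / 2)) * CI * B4Sect5Proof.latticeConst (d + 1) (δ / 2 / 2) *
      B4Sect5Proof.latticeConst (d + 1) (δ / 2 / 4) := ⟨_, rfl⟩
  have hC30 : 0 ≤ C3 := hC3 ▸ mul_nonneg (mul_nonneg (mul_nonneg (mul_nonneg hCI0 (by positivity)) hCI0) hK4) hK8
  refine kernelRate_of_factorRates (d := d) (aplus := aplus) hL hamin (δR := δ / 2 / 4) (ρ := ρ * (C3 + 1)) (by positivity) (by positivity) fun mT k m hk => ?_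
  obtain ⟨a, a', ha1, ha2, ha1', ha2', HR0, HR1⟩ := hpair mT k m hk
  have ha : 0 < a := hamin.trans_le ha1
  have ha' : 0 < a' := hamin.trans_le ha1'
  refine ⟨a, a', ha1, ha2, ha1', ha2', fun s w' k' => ?_, fun k₁ k₂ => ?_⟩
  · -- the gradient rate, with the weaker rate `δ/8` and the larger constant
    have hL0 : 0 < L := Nat.pos_of_ne_zero (NeZero.ne L)
    have hn0 : (0 : ℝ) < ((L ^ k : ℕ) : ℝ) := by exact_mod_cast Nat.one_le_pow _ _ hL0
    have hrγ : 0 ≤ ((L ^ k : ℕ) : ℝ) ^ (-γ) := Real.rpow_nonneg hn0.le _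
    refine (HR1 s w' k').trans ?_
    have ht := tdist_nonneg (MP (paramsOf d L mT k hL)) (cIdx (L ^ k) (MP (paramsOf d L mT k hL)) (torIdx (fine (L ^ k) (MP (paramsOf d L mT k hL))) (kingPr L k m (MP (paramsOf d L mT k hL)) w'))) k'
    refine mul_le_mul (mul_le_mul_of_nonneg_right (le_mul_of_one_le_right hρ.le (by linarith)) hrγ) (Real.exp_le_exp.mpr (by nlinarith)) (Real.exp_nonneg _)
      (mul_nonneg (by positivity) hrγ)
  · -- the inverse's rate from `abs_kerRe_sub_le`
    have hM1 : ∀ i, 1 ≤ MP (paramsOf d L mT k hL) i := fun i => Nat.one_le_iff_ne_zero.mpr (NeZero.ne (MP (paramsOf d L mT k hL) i))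
    have hL0 : 0 < L := Nat.pos_of_ne_zero (NeZero.ne L)
    haveI : NeZero (L ^ m * L ^ k) := ⟨Nat.mul_ne_zero (pow_ne_zero _ (NeZero.ne L)) (pow_ne_zero _ (NeZero.ne L))⟩
    have hn0 : (0 : ℝ) < ((L ^ k : ℕ) : ℝ) := by exact_mod_cast Nat.one_le_pow _ _ hL0
    have hrγ : 0 ≤ ((L ^ k : ℕ) : ℝ) ^ (-γ) := Real.rpow_nonneg hn0.le _
    have hmono : ∀ {C pc κ' CC : ℝ} {N0 : Fin (d + 1) → ℕ} (_ : ∀ i, 1 ≤ N0 i) (X k' : Idx N0), 0 ≤ CC → C * pc ≤ CC → δ ≤ κ' →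
        C * pc * Real.exp (-(κ' * torusSupNorm N0 (toZ X - toZ k'))) ≤ CC * Real.exp (-(δ * tdist N0 X k')) := by
      intro C pc κ' CC N0 hN0 X k' hCC hC hκ
      rw [← tdist_eq_torusSupNorm hN0]
      have ht := tdist_nonneg N0 X k'
      by_cases hCp : 0 ≤ C * pc
      · have hexp : Real.exp (-(κ' * tdist N0 X k')) ≤ Real.exp (-(δ * tdist N0 X k')) :=
          Real.exp_le_exp.mpr (by nlinarith [mul_le_mul_of_nonneg_right hκ ht])
        exact mul_le_mul hC hexp (Real.exp_nonneg _) hCC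
      · have h1 : C * pc * Real.exp (-(κ' * tdist N0 X k')) ≤ 0 :=
          mul_nonpos_of_nonpos_of_nonneg (le_of_lt (not_le.mp hCp)) (Real.exp_nonneg _)
        exact h1.trans (mul_nonneg hCC (Real.exp_nonneg _))
    have hKn : ∀ (n : ℕ) [NeZero n] {b : ℝ}, aminus ≤ b → b ≤ aplus → ∀ (X : Idx (fun i => n * MP (paramsOf d L mT k hL) i)) (k' : Idx (MP (paramsOf d L mT k hL))),
        |KRe n b (MP (paramsOf d L mT k hL)) X k'| ≤ CK * Real.exp (-(δ * tdist (MP (paramsOf d L mT k hL)) (cIdx n (MP (paramsOf d L mT k hL)) X) k')) := by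
      intro n _ b hb1 hb2 X k'
      have h := HKd n b hb1 hb2 (MP (paramsOf d L mT k hL)) hM1 X k'
      rw [← toZ_cIdx] at h
      exact h.trans (hmono hM1 (cIdx n (MP (paramsOf d L mT k hL)) X) k' hCK0 (hCK ▸ le_rfl) hδ1)
    have hIn : ∀ (n : ℕ) [NeZero n] {b : ℝ}, aminus ≤ b → b ≤ aplus → ∀ k₁ k₂ : Idx (MP (paramsOf d L mT k hL)),
        |kerRe n b (MP (paramsOf d L mT k hL)) k₁ k₂| ≤ CI * Real.exp (-(δ * tdist (MP (paramsOf d L mT k hL)) k₁ k₂)) := by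
      intro n _ b hb1 hb2 k₁ k₂
      exact (HId n b hb1 hb2 (MP (paramsOf d L mT k hL)) hM1 k₁ k₂).trans (hmono hM1 k₁ k₂ hCI0 (hCI ▸ le_rfl) hδ2)
    have hR0' : ∀ (w' : Tor (fine (L ^ m * L ^ k) (MP (paramsOf d L mT k hL)))) (k' : Idx (MP (paramsOf d L mT k hL))),
        |KRe (L ^ m * L ^ k) a' (MP (paramsOf d L mT k hL)) (torIdx (fine (L ^ m * L ^ k) (MP (paramsOf d L mT k hL))) w') k'
            - KRe (L ^ k) a (MP (paramsOf d L mT k hL)) (torIdx (fine (L ^ k) (MP (paramsOf d L mT k hL))) (kingPr L k m (MP (paramsOf d L mT k hL)) w')) k'|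
          ≤ ρ * ((L ^ k : ℕ) : ℝ) ^ (-γ) *
            Real.exp (-(δ * tdist (MP (paramsOf d L mT k hL)) (cIdx (L ^ k) (MP (paramsOf d L mT k hL)) (torIdx (fine (L ^ k) (MP (paramsOf d L mT k hL))) (kingPr L k m (MP (paramsOf d L mT k hL)) w'))) k')) :=
      fun w' k' => (HR0 w' k').trans (mul_le_mul_of_nonneg_left (Real.exp_le_exp.mpr (by
        nlinarith [tdist_nonneg (MP (paramsOf d L mT k hL)) (cIdx (L ^ k) (MP (paramsOf d L mT k hL)) (torIdx (fine (L ^ k) (MP (paramsOf d L mT k hL))) (kingPr L k m (MP (paramsOf d L mT k hL)) w'))) k']))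
        (mul_nonneg hρ.le hrγ))
    have h3 := abs_kerRe_sub_le (MP (paramsOf d L mT k hL)) k m ha ha' hCK0 hCI0 hδpos (mul_nonneg hρ.le hrγ)
      (hKn (L ^ k) ha1 ha2) (hKn (L ^ m * L ^ k) ha1' ha2') (hIn (L ^ k) ha1 ha2) (hIn (L ^ m * L ^ k) ha1' ha2') hR0' k₁ k₂
    refine h3.trans ?_
    have hE := Real.exp_nonneg (-(δ / 2 / 4 * tdist (MP (paramsOf d L mT k hL)) k₁ k₂))
    have heq : CI * (2 * (ρ * ((L ^ k : ℕ) : ℝ) ^ (-γ)) * CK * B4Sect5Proof.latticeConst (d + 1) (δ / 2)) * CI * B4Sect5Proof.latticeConst (d + 1) (δ / 2 / 2) *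
        B4Sect5Proof.latticeConst (d + 1) (δ / 2 / 4) = ρ * C3 * ((L ^ k : ℕ) : ℝ) ^ (-γ) := by rw [hC3]; ring
    rw [heq]
    refine mul_le_mul_of_nonneg_right ?_ hE
    calc ρ * C3 * ((L ^ k : ℕ) : ℝ) ^ (-γ) ≤ ρ * (C3 + 1) * ((L ^ k : ℕ) : ℝ) ^ (-γ) :=
          mul_le_mul_of_nonneg_right (mul_le_mul_of_nonneg_left (by linarith) hρ.le) hrγ
      _ = _ := rfl

end KernelRate

/-! ## §59 The kernel rate and the Landau two-grid defect `V′P − PV` on the torus family, hypothesis-free -/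

section Family

variable {L : ℕ} [NeZero L]

/-- ★ **THE CELL-SUMMED TWO-GRID η-RATE OF THE (1.126) KERNEL OF `∂Π∂*` HOLDS ON THE TORUS FAMILY** (part 47's binder `hK`, now a theorem): at King's couplings `a_k`, `a_{k+m}`
(part 52 `KRe_pairRate_member ∕ DKRe_pairRate_member`, window `[aminL a L, a]`), rate `(L^k)^{−γ∕2}`. [cite: Balaban1984PropagatorsI, (1.126) p.38; King1986, Prop. 3.8 (3.71) p.664, Prop. 3.9 (3.73) p.665] -/
theorem kernelRate_family (hLodd : Odd L) (hL2 : 2 ≤ L) {a : ℝ} (ha : 0 < a) {γ : ℝ} (hγ0 : 0 < γ) (hγ1 : γ < 1) :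
    ∃ δK CK : ℝ, 0 < δK ∧ 0 < CK ∧ ∀ (mT k m : ℕ) (hk : 1 ≤ k) (hL : Odd L ∧ 1 < L) (x' : Tor (fine (L ^ m * L ^ k) (MP (paramsOf d L mT k hL)))) (μ : Fin (d + 1))
      (z : Tor (fine (L ^ k) (MP (paramsOf d L mT k hL)))) (ν : Fin (d + 1)),
      |∑ w' ∈ fibre (kingPr L k m (MP (paramsOf d L mT k hL))) z, landauRe (MP (paramsOf d L mT k hL)) (L ^ m * L ^ k) (Pi.single (w', ν) 1) (x', μ)
          - landauRe (MP (paramsOf d L mT k hL)) (L ^ k) (Pi.single (z, ν) 1) (kingPr L k m (MP (paramsOf d L mT k hL)) x', μ)|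
        ≤ CK * ((L ^ k : ℕ) : ℝ) ^ (-(γ / 2)) * ((((L ^ k : ℕ) : ℝ)) ^ (d + 1))⁻¹ * Real.exp (-(δK * distU (L ^ k) (MP (paramsOf d L mT k hL)) (kingPr L k m (MP (paramsOf d L mT k hL)) x') z)) := by
  have hL : Odd L ∧ 1 < L := ⟨hLodd, by omega⟩
  have hamin := aminL_pos ha hL2
  obtain ⟨ρ₁, δ₁, hρ₁, hδ₁, P1⟩ := KRe_pairRate_member (d := d) hLodd hL2 ha hγ0 hγ1
  obtain ⟨ρ₂, δ₂, hρ₂, hδ₂, P2⟩ := DKRe_pairRate_member (d := d) hLodd hL2 ha hγ0 hγ1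
  have hmono : ∀ {ρ' δ' t : ℝ}, 0 ≤ t → 0 ≤ ρ' → ρ' ≤ ρ₁ + ρ₂ → min δ₁ δ₂ ≤ δ' → ∀ k : ℕ,
      ρ' * ((L ^ k : ℕ) : ℝ) ^ (-(γ / 2)) * Real.exp (-(δ' * t)) ≤ (ρ₁ + ρ₂) * ((L ^ k : ℕ) : ℝ) ^ (-(γ / 2)) * Real.exp (-(min δ₁ δ₂ * t)) := by
    intro ρ' δ' t ht hρ' hle hδ k
    have hr : 0 ≤ ((L ^ k : ℕ) : ℝ) ^ (-(γ / 2)) := Real.rpow_nonneg (Nat.cast_nonneg _) _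
    exact mul_le_mul (mul_le_mul_of_nonneg_right hle hr) (Real.exp_le_exp.mpr (by nlinarith)) (Real.exp_nonneg _) (by positivity)
  have key := kernelRate_of_kernelPairRates (d := d) (aplus := a) hL hamin (γ := γ / 2) (lt_min hδ₁ hδ₂) (show 0 < ρ₁ + ρ₂ by positivity)
  refine (key ?_).elim fun δ h => h.elim fun C h => ⟨δ, C, h.1, h.2.1, fun mT k m hk _ => h.2.2 mT k m hk⟩
  intro mT k m hk
  have hak := aminL_le_aK ha hL2 hk
  have hakm := aminL_le_aK ha hL2 (show 1 ≤ k + m by omega)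
  refine ⟨aK a L k, aK a L (k + m), hak.1, hak.2, hakm.1, hakm.2, fun w' k' => ?_, fun s w' k' => ?_⟩
  · exact (P1 mT k m hk hL (MP (paramsOf d L mT k hL)) (fun μ => rfl) w' k').trans
      (hmono (tdist_nonneg _ _ _) hρ₁.le (by linarith) (min_le_left _ _) k)
  · exact (P2 mT k m hk hL (MP (paramsOf d L mT k hL)) (fun μ => rfl) s w' k').trans
      (hmono (tdist_nonneg _ _ _) hρ₂.le (by linarith) (min_le_right _ _) k)

/-- ★ **THE LANDAU TWO-GRID DEFECT `V′P − PV` OF `Δ_a`, ALONE, HAS A BLOCK MAJORANT `C·(L^k)^{−γ∕2}·e^{−δ|y−y′|_T}`, HYPOTHESIS-FREE**: for odd `L ≥ 3`, `a > 0`, `0 < γ < 1` there are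
`δ, C > 0` such that for every torus exponent `m_T`, coarse scale `k ≥ 1` and refinement `m`, with `V = landauRe` (= `∂Π∂*`, (1.69)–(1.70)) on both grids and King's prolongation
`P = pull kingPrV`: `HasMaj (ofBlocks geo blkFine) (ofBlocks geo blockOf_{L^m·L^k}) (V′∘P − P∘V) (C·(L^k)^{−γ∕2}·e^{−δ|y−y′|_T})` (`kernelRate_family` + part 47 `hasMaj_landauDefect_of_kernelRate`).
[cite: Balaban1984PropagatorsI, (1.69)–(1.70) pp.29–30, (1.126) p.38; King1986, Prop. 3.9 (3.73) p.665 (η-rate shape)] -/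
theorem hasMaj_landauDefect_family (hLodd : Odd L) (hL2 : 2 ≤ L) {a : ℝ} (ha : 0 < a) {γ : ℝ} (hγ0 : 0 < γ) (hγ1 : γ < 1) :
    ∃ δ C : ℝ, 0 < δ ∧ 0 < C ∧ ∀ (mT k m : ℕ) (_hk : 1 ≤ k) (hL : Odd L ∧ 1 < L),
      HasMaj (BlockNorm.ofBlocks (unitTorusGeo L k (MP (paramsOf d L mT k hL))) (blkFine L k (MP (paramsOf d L mT k hL))))
        (BlockNorm.ofBlocks (unitTorusGeo L k (MP (paramsOf d L mT k hL)))
          (fun i : Tor (fine (L ^ m * L ^ k) (MP (paramsOf d L mT k hL))) × Fin (d + 1) => blockOf (L ^ m * L ^ k) (MP (paramsOf d L mT k hL)) i.1))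
        (landauRe (MP (paramsOf d L mT k hL)) (L ^ m * L ^ k) ∘ₗ pull (kingPrV L k m (MP (paramsOf d L mT k hL)))
          - pull (kingPrV L k m (MP (paramsOf d L mT k hL))) ∘ₗ landauRe (MP (paramsOf d L mT k hL)) (L ^ k))
        (fun y y' => C * ((L ^ k : ℕ) : ℝ) ^ (-(γ / 2)) * Real.exp (-(δ * tdistT (MP (paramsOf d L mT k hL)) y y'))) := by
  obtain ⟨δK, CK, hδK, hCK, hK⟩ := kernelRate_family (d := d) hLodd hL2 ha hγ0 hγ1
  refine ⟨δK, ((d : ℝ) + 1) * CK * Real.exp δK, hδK, by positivity, fun mT k m hk hL => ?_⟩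
  have hrγ : 0 ≤ ((L ^ k : ℕ) : ℝ) ^ (-(γ / 2)) := Real.rpow_nonneg (Nat.cast_nonneg _) _
  exact hasMaj_landauDefect_of_kernelRate (MP (paramsOf d L mT k hL)) k m hCK.le hδK.le hrγ (hK mT k m hk hL)

end Family

end Summit.QuantumFields.YangMills.BalabanUVNodes.N15.TwoGrid
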